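import Mathlib
import HarnessLib

/-!
# Crux `BirComplexStableXYR`, line `fat-gaussian-defect-calculus`: stub T5 `stub_complementDecay`

Registered stub (lead c8, wave 12, skeleton `Cruxes/BirComplexStableXYR/Lines/fat_gaussian_defect_calculus.lean`,
section TEnd), helper (`--supports`) for the crux
`Summit.HubbardSuperconductivity.HubbardSuperconductivity.Theses.BalabanIR.BirComplexStableXYR`:
**quantitative estimates for the dressed rank-one projector and its complement** (chapter T-end of the line:
the effective 1-D chain whose transfer operator `t` on a complex Banach space `E` is a small perturbation of an
operator with a dominant rank-one idempotent `p₀ = φ(·) e`, `φ e = 1`, and a contracting complement).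

**Statement.** Generic functional analysis in the normed ring `E →L[ℂ] E` (no project definitions).  With
`‖e‖ ≤ 1`, `‖φ‖ ≤ 1`, `φ e = 1`, `0 ≤ δ ≤ 1/8`, `‖v‖ ≤ δ`, `‖w‖ ≤ δ`, `‖q₀ t q₀‖ ≤ θ` where
`p₀ := φ.smulRight e`, `q₀ := 1 - p₀`, and `x := e + v`, `ψ := φ + w`, `p := (ψ x)⁻¹ • ψ.smulRight x`:
(i) `‖ψ x - 1‖ ≤ 3δ`; (ii) `‖p - p₀‖ ≤ 16δ`; (iii) `‖(1 - p) t (1 - p)‖ ≤ θ + 100 δ (‖t‖ + 1)`;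
(iv) `‖((1 - p) t (1 - p))ⁿ‖ ≤ (θ + 100 δ (‖t‖ + 1))ⁿ` for every `n`.

**Proof.** Norm bookkeeping only.  (i) `ψ x - 1 = φ v + w e + w v`, each term bounded through `le_opNorm`.
(ii) `ψ.smulRight x - φ.smulRight e = φ.smulRight v + w.smulRight x` (by `ext`), so its norm is `≤ 3δ`
(`norm_smulRight_apply`); `‖ψ.smulRight x‖ ≤ (1 + δ)² ≤ 2`; from (i), `‖ψ x‖ ≥ 1 - 3δ ≥ 5/8`, hence
`‖(ψ x)⁻¹ - 1‖ ≤ 5δ`; finally `p - p₀ = ((ψ x)⁻¹ - 1) • ψ.smulRight x + (ψ.smulRight x - φ.smulRight e)`.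
(iii) with `q := 1 - p`: `‖q₀‖ ≤ 2`, `‖q‖ ≤ 4`, `‖q - q₀‖ ≤ 16δ`, and
`q t q - q₀ t q₀ = (q - q₀) t q + q₀ t (q - q₀)` has norm `≤ 96 δ ‖t‖`.  (iv) `norm_pow_le'` and
`pow_le_pow_left₀` (the case `n = 0` uses `‖1‖ ≤ 1`, `ContinuousLinearMap.norm_id_le`).  Elementary given
Mathlib; no definition and no named fact is introduced; sorry-free. [folklore]
-/

set_option linter.dupNamespace false -- `Summit.<S>.<S>.Theorems…` repeats the summit name (D-0017 layout)

namespace Summit.HubbardSuperconductivity.HubbardSuperconductivity.Theorems.TEnd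

open scoped ComplexConjugate

/-- Norm of a rank-one operator `φ.smulRight x` is bounded by the product of bounds on `‖φ‖` and `‖x‖`. -/
theorem hsc_norm_smulRight_le {E : Type} [NormedAddCommGroup E] [NormedSpace ℂ E]
    (φ : E →L[ℂ] ℂ) (x : E) {a b : ℝ} (hφ : ‖φ‖ ≤ a) (hx : ‖x‖ ≤ b) :
    ‖φ.smulRight x‖ ≤ a * b := by
  rw [ContinuousLinearMap.norm_smulRight_apply]
  exact mul_le_mul hφ hx (norm_nonneg _) ((norm_nonneg _).trans hφ)

/-- A scalar within `3δ ≤ 3/8` of `1` has inverse within `5δ` of `1`. -/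
theorem hsc_inv_sub_one_le (c : ℂ) {δ : ℝ} (hδ0 : 0 ≤ δ) (hδ : δ ≤ 1 / 8)
    (hc : ‖c - 1‖ ≤ 3 * δ) : ‖c⁻¹ - 1‖ ≤ 5 * δ := by
  have hc_lower : 5 / 8 ≤ ‖c‖ := by
    have h1 : ‖(1 : ℂ)‖ - ‖c - 1‖ ≤ ‖c‖ := by
      have := norm_sub_norm_le (1 : ℂ) (1 - c)
      rw [sub_sub_cancel, norm_sub_rev] at this
      linarith
    rw [norm_one] at h1
    linarith
  have hc_ne : c ≠ 0 := by
    intro h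
    rw [h, norm_zero] at hc_lower
    linarith
  have hid : c⁻¹ - 1 = (1 - c) * c⁻¹ := by
    field_simp
  have hprod : ‖c⁻¹ - 1‖ * ‖c‖ = ‖c - 1‖ := by
    rw [← norm_mul, sub_mul, inv_mul_cancel₀ hc_ne, one_mul, norm_sub_rev]
  nlinarith [norm_nonneg (c⁻¹ - 1), mul_le_mul_of_nonneg_left hc_lower (norm_nonneg (c⁻¹ - 1))]

/-- Powers of an operator whose norm is at most `B` have norm at most `Bⁿ` (the case `n = 0` uses
`‖1‖ ≤ 1` in `E →L[ℂ] E`, valid also for the trivial space). -/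
theorem hsc_norm_pow_le {E : Type} [NormedAddCommGroup E] [NormedSpace ℂ E]
    (A : E →L[ℂ] E) {B : ℝ} (hA : ‖A‖ ≤ B) (n : ℕ) : ‖A ^ n‖ ≤ B ^ n := by
  cases n with
  | zero =>
    rw [pow_zero, pow_zero]
    exact ContinuousLinearMap.norm_id_le
  | succ k =>
    exact (norm_pow_le' A k.succ_pos).trans (pow_le_pow_left₀ (norm_nonneg _) hA _)

/-- **Stub T5 `stub_complementDecay` (chapter T-end, generic): quantitative estimates for the dressed
rank-one projector `p = (ψ x)⁻¹ • ψ.smulRight x` and the complement block `(1 - p) t (1 - p)`.** -/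
theorem stub_complementDecay :
    ∀ (E : Type) [NormedAddCommGroup E] [NormedSpace ℂ E]
      (t : E →L[ℂ] E) (e : E) (φ : E →L[ℂ] ℂ) (v : E) (w : E →L[ℂ] ℂ) (θ δ : ℝ),
      ‖e‖ ≤ 1 → ‖φ‖ ≤ 1 → φ e = 1 → 0 ≤ δ → δ ≤ 1 / 8 → ‖v‖ ≤ δ → ‖w‖ ≤ δ →
      ‖((1 : E →L[ℂ] E) - φ.smulRight e) * t * ((1 : E →L[ℂ] E) - φ.smulRight e)‖ ≤ θ →
        let x : E := e + v
        let ψ : E →L[ℂ] ℂ := φ + w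
        let p : E →L[ℂ] E := (ψ x)⁻¹ • ψ.smulRight x
        ‖ψ x - 1‖ ≤ 3 * δ ∧ ‖p - φ.smulRight e‖ ≤ 16 * δ ∧
        ‖((1 : E →L[ℂ] E) - p) * t * ((1 : E →L[ℂ] E) - p)‖ ≤ θ + 100 * δ * (‖t‖ + 1) ∧
        ∀ n : ℕ, ‖(((1 : E →L[ℂ] E) - p) * t * ((1 : E →L[ℂ] E) - p)) ^ n‖ ≤ (θ + 100 * δ * (‖t‖ + 1)) ^ n := by
  intro E _ _ t e φ v w θ δ he hφ hφe hδ0 hδ hv hw hθ x ψ p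
  -- norms of the perturbed vector and covector
  have hx : ‖x‖ ≤ 1 + δ := (norm_add_le e v).trans (add_le_add he hv)
  have hψ : ‖ψ‖ ≤ 1 + δ := (norm_add_le φ w).trans (add_le_add hφ hw)
  -- (i) the overlap `ψ x` is close to `1`
  have h_i : ‖ψ x - 1‖ ≤ 3 * δ := by
    have hsplit : ψ x - 1 = φ v + w e + w v := by
      show (φ + w) (e + v) - 1 = _
      simp only [add_apply, map_add, hφe]
      ring
    rw [hsplit]
    have h1 : ‖φ v‖ ≤ δ := by
      refine (φ.le_opNorm v).trans ?_
      calc ‖φ‖ * ‖v‖ ≤ 1 * δ := mul_le_mul hφ hv (norm_nonneg _) zero_le_one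
        _ = δ := one_mul δ
    have h2 : ‖w e‖ ≤ δ := by
      refine (w.le_opNorm e).trans ?_
      calc ‖w‖ * ‖e‖ ≤ δ * 1 := mul_le_mul hw he (norm_nonneg _) hδ0
        _ = δ := mul_one δ
    have h3 : ‖w v‖ ≤ δ := by
      refine (w.le_opNorm v).trans ?_
      calc ‖w‖ * ‖v‖ ≤ δ * δ := mul_le_mul hw hv (norm_nonneg _) hδ0
        _ ≤ δ := by nlinarith
    calc ‖φ v + w e + w v‖ ≤ ‖φ v‖ + ‖w e‖ + ‖w v‖ := norm_add₃_le
      _ ≤ δ + δ + δ := by linarith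
      _ = 3 * δ := by ring
  -- (ii) the dressed projector is close to `p₀ = φ.smulRight e`
  have hS_sub : ψ.smulRight x - φ.smulRight e = φ.smulRight v + w.smulRight x := by
    ext y
    simp only [sub_apply, add_apply, ContinuousLinearMap.smulRight_apply]
    show (φ y + w y) • (e + v) - φ y • e = φ y • v + w y • (e + v)
    simp only [add_smul, smul_add]
    abel
  have hS_sub_norm : ‖ψ.smulRight x - φ.smulRight e‖ ≤ 3 * δ := by
    rw [hS_sub]
    calc ‖φ.smulRight v + w.smulRight x‖ ≤ ‖φ.smulRight v‖ + ‖w.smulRight x‖ := norm_add_le _ _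
      _ ≤ 1 * δ + δ * (1 + δ) :=
          add_le_add (hsc_norm_smulRight_le φ v hφ hv) (hsc_norm_smulRight_le w x hw hx)
      _ ≤ 3 * δ := by nlinarith
  have hS_norm : ‖ψ.smulRight x‖ ≤ 2 :=
    (hsc_norm_smulRight_le ψ x hψ hx).trans (by nlinarith)
  have hinv : ‖(ψ x)⁻¹ - 1‖ ≤ 5 * δ := hsc_inv_sub_one_le (ψ x) hδ0 hδ h_i
  have hp_split : p - φ.smulRight e =
      ((ψ x)⁻¹ - 1) • ψ.smulRight x + (ψ.smulRight x - φ.smulRight e) := by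
    show (ψ x)⁻¹ • ψ.smulRight x - φ.smulRight e = _
    rw [sub_smul, one_smul]
    abel
  have h_ii : ‖p - φ.smulRight e‖ ≤ 16 * δ := by
    rw [hp_split]
    calc ‖((ψ x)⁻¹ - 1) • ψ.smulRight x + (ψ.smulRight x - φ.smulRight e)‖
        ≤ ‖((ψ x)⁻¹ - 1) • ψ.smulRight x‖ + ‖ψ.smulRight x - φ.smulRight e‖ := norm_add_le _ _
      _ = ‖(ψ x)⁻¹ - 1‖ * ‖ψ.smulRight x‖ + ‖ψ.smulRight x - φ.smulRight e‖ := by rw [norm_smul]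
      _ ≤ 5 * δ * 2 + 3 * δ :=
          add_le_add (mul_le_mul hinv hS_norm (norm_nonneg _) (by linarith)) hS_sub_norm
      _ ≤ 16 * δ := by linarith
  -- (iii) the complement block
  have hone : ‖(1 : E →L[ℂ] E)‖ ≤ 1 := ContinuousLinearMap.norm_id_le
  have hp0 : ‖φ.smulRight e‖ ≤ 1 := (hsc_norm_smulRight_le φ e hφ he).trans (by norm_num)
  have hq0 : ‖(1 : E →L[ℂ] E) - φ.smulRight e‖ ≤ 2 :=
    (norm_sub_le _ _).trans (by linarith)
  have hqq0 : ‖((1 : E →L[ℂ] E) - p) - ((1 : E →L[ℂ] E) - φ.smulRight e)‖ ≤ 16 * δ := by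
    rw [sub_sub_sub_cancel_left, norm_sub_rev]
    exact h_ii
  have hq : ‖(1 : E →L[ℂ] E) - p‖ ≤ 4 := by
    have := norm_le_insert' ((1 : E →L[ℂ] E) - p) ((1 : E →L[ℂ] E) - φ.smulRight e)
    have hδ2 : 16 * δ ≤ 2 := by linarith
    linarith
  have hdiff_id : ((1 : E →L[ℂ] E) - p) * t * ((1 : E →L[ℂ] E) - p) -
      ((1 : E →L[ℂ] E) - φ.smulRight e) * t * ((1 : E →L[ℂ] E) - φ.smulRight e) =
      (((1 : E →L[ℂ] E) - p) - ((1 : E →L[ℂ] E) - φ.smulRight e)) * t * ((1 : E →L[ℂ] E) - p) +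
      ((1 : E →L[ℂ] E) - φ.smulRight e) * t *
        (((1 : E →L[ℂ] E) - p) - ((1 : E →L[ℂ] E) - φ.smulRight e)) := by
    noncomm_ring
  have hdiff_norm : ‖((1 : E →L[ℂ] E) - p) * t * ((1 : E →L[ℂ] E) - p) -
      ((1 : E →L[ℂ] E) - φ.smulRight e) * t * ((1 : E →L[ℂ] E) - φ.smulRight e)‖ ≤
      100 * δ * (‖t‖ + 1) := by
    rw [hdiff_id]
    have ht0 : 0 ≤ ‖t‖ := norm_nonneg t
    calc _ ≤ ‖(((1 : E →L[ℂ] E) - p) - ((1 : E →L[ℂ] E) - φ.smulRight e)) * t * ((1 : E →L[ℂ] E) - p)‖ +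
          ‖((1 : E →L[ℂ] E) - φ.smulRight e) * t *
            (((1 : E →L[ℂ] E) - p) - ((1 : E →L[ℂ] E) - φ.smulRight e))‖ := norm_add_le _ _
      _ ≤ ‖((1 : E →L[ℂ] E) - p) - ((1 : E →L[ℂ] E) - φ.smulRight e)‖ * ‖t‖ * ‖(1 : E →L[ℂ] E) - p‖ +
          ‖(1 : E →L[ℂ] E) - φ.smulRight e‖ * ‖t‖ *
            ‖((1 : E →L[ℂ] E) - p) - ((1 : E →L[ℂ] E) - φ.smulRight e)‖ :=
          add_le_add norm_mul₃_le norm_mul₃_le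
      _ ≤ 16 * δ * ‖t‖ * 4 + 2 * ‖t‖ * (16 * δ) := by
          apply add_le_add
          · exact mul_le_mul (mul_le_mul_of_nonneg_right hqq0 ht0) hq (norm_nonneg _)
              (by positivity)
          · exact mul_le_mul (mul_le_mul_of_nonneg_right hq0 ht0) hqq0 (norm_nonneg _)
              (by positivity)
      _ ≤ 100 * δ * (‖t‖ + 1) := by nlinarith
  have h_iii : ‖((1 : E →L[ℂ] E) - p) * t * ((1 : E →L[ℂ] E) - p)‖ ≤ θ + 100 * δ * (‖t‖ + 1) := by
    have := norm_le_insert' (((1 : E →L[ℂ] E) - p) * t * ((1 : E →L[ℂ] E) - p))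
      (((1 : E →L[ℂ] E) - φ.smulRight e) * t * ((1 : E →L[ℂ] E) - φ.smulRight e))
    linarith
  -- (iv) powers
  exact ⟨h_i, h_ii, h_iii, fun n => hsc_norm_pow_le _ h_iii n⟩

end Summit.HubbardSuperconductivity.HubbardSuperconductivity.Theorems.TEnd
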